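import Summits.BirchSwinnertonDyer.BirchSwinnertonDyer.Theorems.KimAtThreeDeepLowerS24DeepTorsionAtOne
import Summits.BirchSwinnertonDyer.Rank1Residual.GaloisImage.KolyvaginInjectivityAllDepthsLe
import HarnessLib

/-!
# Rigidity of Kolyvagin systems on `(E[3^k·3], 𝓕_can)` over the DEEP Frobenius sub-class at every depth
# `k ≤ k′` — evaluation at ONE residual core vertex is injective — WITHOUT the S24-DEEP port
# (route `KimAtThreeKolyvagin`, rung W2; cell `bsd-addord`, seat `bsd-addord-w2-c2` gen 5)

HONEST FRAMING. Theorems only (no definition, no named fact, no `sorry`); nothing booked, no mark moved;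
BSD is not proved by any of this. n1011's `TorsionLevel.injective_eval_kolyvaginSystems_allDepths_le`
(cell `b2b-bsdres`, row T-INJ-DEV-K) lifts the `m = 1` rigidity `hinj₁` of a datum `D₁` on `E[3]` to
every depth `k` for a tower of data `D j` (`j ≤ k`) on the SAME prime set `P ⊆ 𝒫_{k+1}` with canonical
comparison maps; on the DEEP class `P = frobeniusClassPrimes (E[3^{k′}·3]) S τ 3^{k′+1}` (`k ≤ k′`) the
input `hinj₁` at a GENERAL core vertex was open (n1011 had it at `∅`, base rigidity) and the deep rows
took rigidity from the flagged port S24-DEEP (1) instead (this seat's gen-3 `KimAtThreeStubOfS24Deep`,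
`apply_eq_zero_of_free_of_fullOrder`). With `KimAtThreeDeepLowerS24DeepTorsionAtOne.kolyvaginSystem_eq_zero_of_apply_core_eq_zero_deep`
(this seat, from the deep Lemma 5.2) the input is a THEOREM:

* **`apply_eq_zero_of_apply_eq_zero_allDepths_le_deep`** / **`injective_eval_kolyvaginSystems_allDepths_le_deep`**
  — for `k ≤ k′`, a tower `D j` (`j ≤ k`) of Kolyvagin data on `E[3^j·3]` and `D₁` on `E[3]`, all with
  primes THE DEEP CLASS at level `3^{k′+1}`, cyclotomic transverse conditions and canonical comparison
  maps for one `η`, and a level `n₀` of the deep class with `λ^*(n₀) = 0` for `(E[3], 𝓕̄_can)`: a Kolyvagin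
  system for `(E[3^k·3], 𝓕_can, D k)` vanishing at `n₀` vanishes identically; `κ ↦ κ_{n₀}` is injective.
  Binders = n1011's `…_allDepths_le` VERBATIM (with `P` the deep class) minus `hinj₁`, `hP₁…`, plus the
  discharging data of `…TorsionAtOne` (surj(3), the deepest `τ`-datum, `inv` ×4, `hEP`, `S ⊇ ∞ ∪ {3} ∪ {bad}`,
  `hD₁`, `hcore`). NO port.

References: R. Sakamoto, JTNB **36** (2024) Thm. 4.4 (1) (p. 926) [Sakamoto2024]; K. Rubin, PCMI 18 (2011)
Cor. 2.8.9 [Rubin2011]; B. Mazur, K. Rubin, Mem. AMS **799** (2004) Thm. 4.4.1, §4.5, Prop. A.2 [MazurRubin2004].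
-/

set_option autoImplicit false
-- the Theorems namespace of a single-conjunct summit repeats the summit name by design (D-0017)
set_option linter.dupNamespace false

noncomputable section

open scoped Classical NumberField ContRepresentation
open Function Field NumberField IsDedekindDomain Module
open WeierstrassCurve Literature.NumberTheory.EllipticCurves Literature.NumberTheory.EllipticCurves.Rank1Residual
  Literature.NumberTheory.GaloisRepresentations
  Literature.NumberTheory.GaloisRepresentations.DiscreteGaloisModule Literature.NumberTheory.GaloisCohomology

namespace Summit.BirchSwinnertonDyer.BirchSwinnertonDyer.Theorems.KimAtThreeDeepLowerS24DeepRigidity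

open Summit.BirchSwinnertonDyer.Rank1Residual.GaloisImage
open Summit.BirchSwinnertonDyer.BirchSwinnertonDyer.Theorems.KimAtThreeDeepLowerS24DeepTorsionAtOne

variable (W : WeierstrassCurve ℚ) [W.IsElliptic]

/-- **Rigidity at every depth on the DEEP class, port-free**: n1011's
`TorsionLevel.apply_eq_zero_of_apply_eq_zero_allDepths_le` with `P` = the deep class
`frobeniusClassPrimes (E[3^{k′}·3]) {v | inr v ∈ S} τ 3^{k′+1}` (`k ≤ k′`) and its `m = 1` input `hinj₁`
DISCHARGED at ANY level `n₀` of the class with `λ^*(n₀) = 0` by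
`kolyvaginSystem_eq_zero_of_apply_core_eq_zero_deep` (surj(3); the deep Lemma 5.2). For a Kolyvagin system
`κ` of `(E[3^k·3], 𝓕_can, D k)`: `κ_{n₀} = 0 ⟹ κ = 0`. [cite: Sakamoto2024, Thm. 4.4 (1) (p. 926)]
[cite: Rubin2011, Cor. 2.8.9 (p. 25)] [cite: MazurRubin2004, Thm. 4.4.1 and Prop. A.2] -/
theorem apply_eq_zero_of_apply_eq_zero_allDepths_le_deep [Finite (geomTorsion W ((3 : ℕ) : ℤ))]
    (h3 : W.HasSurjectiveModNGaloisRep ((3 : ℕ) : ℤ)) {k k' : ℕ} (hk : 1 ≤ k) (hkk' : k ≤ k')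
    (τ : absoluteGaloisGroup ℚ) (hτμ : τ ∈ rootsOfUnityFixer ℚ (3 ^ (k' + 1)))
    (hτ₁ : Nonempty (cokerSubOne (W.torsionGaloisModule ((3 : ℕ) : ℤ)) τ ≃+ ZMod 3))
    (hτ : ∀ j, j ≤ k → Nonempty (cokerSubOne (W.torsionGaloisModule (((3 : ℕ) : ℤ) ^ j * ((3 : ℕ) : ℤ))) τ ≃+
      ZMod (3 ^ (j + 1))))
    (inv : LocalInvariants ℚ 3) (hperf : inv.IsPerfect) (hsum : inv.SumLocalTermEqZero)
    (hunro : inv.UnramifiedOrthogonal) (hcompl : inv.SelmerComplement)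
    (hEP : ∀ v : HeightOneSpectrum (𝓞 ℚ), localEulerPoincareCharacteristic (v.adicCompletion ℚ))
    (S : Finset (Place ℚ)) (hS : ∀ w : InfinitePlace ℚ, (Sum.inl w : Place ℚ) ∈ S)
    (h3S : ∀ v : HeightOneSpectrum (𝓞 ℚ), ((3 : ℕ) : 𝓞 ℚ) ∈ v.asIdeal → (Sum.inr v : Place ℚ) ∈ S)
    (hbadS : ∀ v : HeightOneSpectrum (𝓞 ℚ), ¬ W.HasGoodReductionAt v → (Sum.inr v : Place ℚ) ∈ S)
    (h0 : ∀ j, j ≤ k → ∀ P : geomTorsion W (((3 : ℕ) : ℤ) ^ j * ((3 : ℕ) : ℤ)),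
      (∀ σ : absoluteGaloisGroup ℚ,
        W.torsionGaloisModule (((3 : ℕ) : ℤ) ^ j * ((3 : ℕ) : ℤ)) σ P = P) → P = 0)
    (h0₁ : ∀ P : geomTorsion W ((3 : ℕ) : ℤ),
      (∀ σ : absoluteGaloisGroup ℚ, W.torsionGaloisModule ((3 : ℕ) : ℤ) σ P = P) → P = 0)
    (η : (q : HeightOneSpectrum (𝓞 ℚ)) → (ZMod (Ideal.absNorm q.asIdeal))ˣ)
    (D : (j : ℕ) → KolyvaginDatum (W.torsionGaloisModule (((3 : ℕ) : ℤ) ^ j * ((3 : ℕ) : ℤ))))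
    (D₁ : KolyvaginDatum (W.torsionGaloisModule ((3 : ℕ) : ℤ)))
    (hP₁ : D₁.primes = frobeniusClassPrimes (W.torsionGaloisModule (((3 : ℕ) : ℤ) ^ k' * ((3 : ℕ) : ℤ)))
      {v | (Sum.inr v : Place ℚ) ∈ S} τ (3 ^ (k' + 1)))
    (hT₁ : D₁.transverse = cyclotomicTransverse _) (hD₁ : D₁.HasCanonicalComparison 3 η)
    (hP : ∀ j, j ≤ k → (D j).primes = frobeniusClassPrimes
      (W.torsionGaloisModule (((3 : ℕ) : ℤ) ^ k' * ((3 : ℕ) : ℤ))) {v | (Sum.inr v : Place ℚ) ∈ S} τ (3 ^ (k' + 1)))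
    (hT : ∀ j, j ≤ k → (D j).transverse = cyclotomicTransverse _)
    (hD : ∀ j, j ≤ k → (D j).HasCanonicalComparison (3 ^ (j + 1)) η)
    (hadm : ∀ j, j ≤ k → (D j).IsAdmissible)
    {n₀ : Finset (HeightOneSpectrum (𝓞 ℚ))} (hn₀ : D₁.IsLevel n₀)
    (hcore : LocalInvariants.lambdaStar inv (D₁.atLevel (propagatedSelmerStructureOne W 3) n₀) 3 = 0)
    {κ : Finset (HeightOneSpectrum (𝓞 ℚ)) →
      galoisCohomology (W.torsionGaloisModule (((3 : ℕ) : ℤ) ^ k * ((3 : ℕ) : ℤ))) 1}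
    (hκ : (D k).IsKolyvaginSystem (propagatedSelmerStructure W 3 k) κ) (h0κ : κ n₀ = 0)
    (n : Finset (HeightOneSpectrum (𝓞 ℚ))) : κ n = 0 := by
  haveI : Fact (Nat.Prime 3) := ⟨Nat.prime_three⟩
  haveI : Finite (geomTorsion W (((3 : ℕ) : ℤ) ^ k' * ((3 : ℕ) : ℤ))) := finite_geomTorsion_pow_mul W 3 k'
  -- the deep class lies inside the level-`3^{k+1}` class of `E[3^k·3]`, and outside `S`
  set P : Set (HeightOneSpectrum (𝓞 ℚ)) := frobeniusClassPrimes
    (W.torsionGaloisModule (((3 : ℕ) : ℤ) ^ k' * ((3 : ℕ) : ℤ))) {v | (Sum.inr v : Place ℚ) ∈ S} τ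
      (3 ^ (k' + 1)) with hPdef
  have hdvd : 3 ^ (k + 1) ∣ 3 ^ (k' + 1) := pow_dvd_pow 3 (Nat.succ_le_succ hkk')
  have hker : ∀ u : absoluteGaloisGroup ℚ,
      W.torsionGaloisModule (((3 : ℕ) : ℤ) ^ k' * ((3 : ℕ) : ℤ)) u = 1 →
        W.torsionGaloisModule (((3 : ℕ) : ℤ) ^ k * ((3 : ℕ) : ℤ)) u = 1 := fun u hu =>
    S24Deep.torsionGaloisModule_eq_one_of_dvd W (Transport.pow_mul_dvd_pow_mul hkk') u hu
  have hPc : P ⊆ frobeniusClassPrimes (W.torsionGaloisModule (((3 : ℕ) : ℤ) ^ k * ((3 : ℕ) : ℤ)))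
      {v | (Sum.inr v : Place ℚ) ∈ S} τ (3 ^ (k + 1)) :=
    S24Deep.frobeniusClassPrimes_mono _ _ hker _ τ hdvd
  have hPS : ∀ q ∈ P, (Sum.inr q : Place ℚ) ∉ S := fun q hq => hq.1
  have hτμk : τ ∈ rootsOfUnityFixer ℚ (3 ^ (k + 1)) := rootsOfUnityFixer_le_of_dvd ℚ hdvd hτμ
  -- the `m = 1` rigidity on the deep class (this seat's TorsionAtOne §2)
  have hinj₁ : ∀ lam : Finset (HeightOneSpectrum (𝓞 ℚ)) →
        galoisCohomology (W.torsionGaloisModule ((3 : ℕ) : ℤ)) 1,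
      D₁.IsKolyvaginSystem (propagatedSelmerStructureOne W 3) lam → lam n₀ = 0 → ∀ m, lam m = 0 :=
    kolyvaginSystem_eq_zero_of_apply_core_eq_zero_deep W h3 k' τ hτμ hτ₁ inv hperf hsum hunro hcompl hEP S
      hS h3S hbadS D₁ η hP₁ hT₁ hD₁ hn₀ hcore
  exact TorsionLevel.apply_eq_zero_of_apply_eq_zero_allDepths_le W h0₁
    (propagatedSelmerStructureOne_three_isUnramifiedOutside W S hS h3S hbadS) hτ₁ D D₁ hP₁ hPS hT₁ hD₁
    hinj₁ k hk h0 (fun j _ => propagatedSelmerStructure_isUnramifiedOutside W 3 j S hS h3S hbadS) hτμk hτ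
    hP hPc hT hD hadm hκ h0κ n

/-- **Evaluation at `n₀` is injective on `KS(E[3^k·3], 𝓕_can, D k)` for the DEEP-class tower, port-free**
(subgroup form of `apply_eq_zero_of_apply_eq_zero_allDepths_le_deep`). [cite: Sakamoto2024, Thm. 4.4 (1) (p. 926)]
[cite: Rubin2011, Cor. 2.8.9 (p. 25)] -/
theorem injective_eval_kolyvaginSystems_allDepths_le_deep [Finite (geomTorsion W ((3 : ℕ) : ℤ))]
    (h3 : W.HasSurjectiveModNGaloisRep ((3 : ℕ) : ℤ)) {k k' : ℕ} (hk : 1 ≤ k) (hkk' : k ≤ k')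
    (τ : absoluteGaloisGroup ℚ) (hτμ : τ ∈ rootsOfUnityFixer ℚ (3 ^ (k' + 1)))
    (hτ₁ : Nonempty (cokerSubOne (W.torsionGaloisModule ((3 : ℕ) : ℤ)) τ ≃+ ZMod 3))
    (hτ : ∀ j, j ≤ k → Nonempty (cokerSubOne (W.torsionGaloisModule (((3 : ℕ) : ℤ) ^ j * ((3 : ℕ) : ℤ))) τ ≃+
      ZMod (3 ^ (j + 1))))
    (inv : LocalInvariants ℚ 3) (hperf : inv.IsPerfect) (hsum : inv.SumLocalTermEqZero)
    (hunro : inv.UnramifiedOrthogonal) (hcompl : inv.SelmerComplement)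
    (hEP : ∀ v : HeightOneSpectrum (𝓞 ℚ), localEulerPoincareCharacteristic (v.adicCompletion ℚ))
    (S : Finset (Place ℚ)) (hS : ∀ w : InfinitePlace ℚ, (Sum.inl w : Place ℚ) ∈ S)
    (h3S : ∀ v : HeightOneSpectrum (𝓞 ℚ), ((3 : ℕ) : 𝓞 ℚ) ∈ v.asIdeal → (Sum.inr v : Place ℚ) ∈ S)
    (hbadS : ∀ v : HeightOneSpectrum (𝓞 ℚ), ¬ W.HasGoodReductionAt v → (Sum.inr v : Place ℚ) ∈ S)
    (h0 : ∀ j, j ≤ k → ∀ P : geomTorsion W (((3 : ℕ) : ℤ) ^ j * ((3 : ℕ) : ℤ)),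
      (∀ σ : absoluteGaloisGroup ℚ,
        W.torsionGaloisModule (((3 : ℕ) : ℤ) ^ j * ((3 : ℕ) : ℤ)) σ P = P) → P = 0)
    (h0₁ : ∀ P : geomTorsion W ((3 : ℕ) : ℤ),
      (∀ σ : absoluteGaloisGroup ℚ, W.torsionGaloisModule ((3 : ℕ) : ℤ) σ P = P) → P = 0)
    (η : (q : HeightOneSpectrum (𝓞 ℚ)) → (ZMod (Ideal.absNorm q.asIdeal))ˣ)
    (D : (j : ℕ) → KolyvaginDatum (W.torsionGaloisModule (((3 : ℕ) : ℤ) ^ j * ((3 : ℕ) : ℤ))))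
    (D₁ : KolyvaginDatum (W.torsionGaloisModule ((3 : ℕ) : ℤ)))
    (hP₁ : D₁.primes = frobeniusClassPrimes (W.torsionGaloisModule (((3 : ℕ) : ℤ) ^ k' * ((3 : ℕ) : ℤ)))
      {v | (Sum.inr v : Place ℚ) ∈ S} τ (3 ^ (k' + 1)))
    (hT₁ : D₁.transverse = cyclotomicTransverse _) (hD₁ : D₁.HasCanonicalComparison 3 η)
    (hP : ∀ j, j ≤ k → (D j).primes = frobeniusClassPrimes
      (W.torsionGaloisModule (((3 : ℕ) : ℤ) ^ k' * ((3 : ℕ) : ℤ))) {v | (Sum.inr v : Place ℚ) ∈ S} τ (3 ^ (k' + 1)))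
    (hT : ∀ j, j ≤ k → (D j).transverse = cyclotomicTransverse _)
    (hD : ∀ j, j ≤ k → (D j).HasCanonicalComparison (3 ^ (j + 1)) η)
    (hadm : ∀ j, j ≤ k → (D j).IsAdmissible)
    {n₀ : Finset (HeightOneSpectrum (𝓞 ℚ))} (hn₀ : D₁.IsLevel n₀)
    (hcore : LocalInvariants.lambdaStar inv (D₁.atLevel (propagatedSelmerStructureOne W 3) n₀) 3 = 0) :
    Function.Injective fun κ : (D k).kolyvaginSystems (propagatedSelmerStructure W 3 k) => κ.1 n₀ := by
  intro κ κ' hκκ'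
  have hmem : κ.1 - κ'.1 ∈ (D k).kolyvaginSystems (propagatedSelmerStructure W 3 k) := sub_mem κ.2 κ'.2
  have hd0 : (κ.1 - κ'.1) n₀ = 0 := by
    change κ.1 n₀ - κ'.1 n₀ = 0
    exact sub_eq_zero.mpr hκκ'
  have hall := apply_eq_zero_of_apply_eq_zero_allDepths_le_deep W h3 hk hkk' τ hτμ hτ₁ hτ inv hperf hsum
    hunro hcompl hEP S hS h3S hbadS h0 h0₁ η D D₁ hP₁ hT₁ hD₁ hP hT hD hadm hn₀ hcore
    ((KolyvaginDatum.mem_kolyvaginSystems_iff _ _ _).mp hmem) hd0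
  apply Subtype.ext
  funext m
  exact sub_eq_zero.mp (hall m)

end Summit.BirchSwinnertonDyer.BirchSwinnertonDyer.Theorems.KimAtThreeDeepLowerS24DeepRigidity

end
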